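import Mathlib
import Literature.Probability.LatticeModels.GKSInequalities
import Summits.CriticalPhenomena.Ising3DConformalLimit.Theorems.PrecisionLaplacianInverseMFerromagnetEntryNonposOfPcov
import Summits.CriticalPhenomena.Ising3DConformalLimit.Theorems.PrecisionLaplacianInverseMFerromagnetRowDegLeTwo
import Summits.CriticalPhenomena.Ising3DConformalLimit.Theorems.PrecisionLaplacianInverseMFerromagnetImNonadjOfLaw2Aux
import HarnessLib

/-!
# Crux `PrecisionLaplacian.InverseMFerromagnet` (stmt-CriticalPhenomena-4798), line `Sketch` —
# stub `helper_twin_nonpos` (W1: non-adjacent twins of degree ≤ 3)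

THEOREM-ONLY file (no definitions).  Let `Σ = (⟨σ_pσ_q⟩)` be the second-moment matrix of the
zero-field pair ferromagnet `μ = gksExpect univ K C` (`K ≥ 0`, `|C i| = 2`) on `Fin n`, and let
`x ≠ y` be non-adjacent *twins*: `x` lies in at most three bonds and a site `z ∉ {x, y}` is a
neighbour of `x` iff it is a neighbour of `y`.  Then `(Σ⁻¹)_xy ≤ 0`, unconditionally.

Proof (the special case `A = B` of C2, `…ImNonadjOfLaw2.lean`, where `Law₂` degenerates into the
nonnegativity of a partial *variance*).  If `deg x ≤ 2` this is C3 (`stub_row_deg_le_two`).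
Otherwise let `T` be the common neighbour set (`|T| ≤ 3`), enumerated by three common slots
`v₀, v₁, v₂ ∉ {x, y}` (`twin_slots`), so that the local fields are `h_x = ∑_j a_jσ_{v_j}`,
`h_y = ∑_j b_jσ_{v_j}` with `a, b ≥ 0` (`twin_field`: parallel bonds are summed).  By the Callen
identity (`c2_integrate`) and `σ_x ⊥ σ_y | σ_R` (`R = univ ∖ {x,y}`), the partial covariance
`PCov(x,y|R) = Σ_xy − Σ_xR(Σ_RR)⁻¹Σ_Ry` is the residual pairing `Res(f_x, f_y)` in `L²(μ)` modulo
the span of `{σ_p : p ∈ R}`, `f_x = tanh h_x`, `f_y = tanh h_y`.  The Walsh forms (`c2_three`)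
`f_x = ∑ α_jσ_{v_j} + κ_x e`, `f_y = ∑ β_jσ_{v_j} + κ_y e` share the SAME cubic
`e = σ_{v₀}σ_{v₁}σ_{v₂}` and have `κ_x, κ_y ≤ 0`, so by `c2_res_lin`, `c2_res_symm`
`Res(f_x, f_y) = κ_xκ_y Res(e, e) ≥ 0`, because `Res(e, e) = min_c ∑ P (e − ∑ c_pσ_p)² ≥ 0`
(`l3_gram_residual_nonneg`).  S1 (`stub_entry_nonpos_of_pcov`) turns `PCov ≥ 0` into
`(Σ⁻¹)_xy ≤ 0`.  (Repeated or padded slots need no separate treatment: the sign argument does not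
use that the `v_j` are distinct.)
-/

namespace Summit.CriticalPhenomena.Ising3DConformalLimit.Cruxes.InverseMFerromagnet.PartialCovarianceLadder

open Literature.Probability.LatticeModels Finset Matrix

noncomputable section

/-- **Three common slots.** A set `T` with `|T| ≤ 3` of admissible sites is enumerated by three
slots `v_j` (padded with an admissible default `d`) and weights `ε_j ∈ {0, 1}` such that
`∑_{z ∈ T} K_z σ_z = ∑_j ε_j K_{v_j} σ_{v_j}` for EVERY coefficient vector `K`. [folklore] -/
theorem twin_slots {V : Type*} [DecidableEq V] (T : Finset V) (hT : T.card ≤ 3) (P : V → Prop)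
    (d : V) (hd : P d) (ho : ∀ z ∈ T, P z) :
    ∃ (v : Fin 3 → V) (ε : Fin 3 → ℝ), (∀ j, P (v j)) ∧ (∀ j, 0 ≤ ε j) ∧
      ∀ (Kf : V → ℝ) (σ : V → ℝ), ∑ z ∈ T, Kf z * σ z = ∑ j, ε j * Kf (v j) * σ (v j) := by
  -- adapted from `c2_slots` (…ImNonadjOfLaw2Aux.lean), uniform in the coefficient vector
  obtain h | h | h | h : T.card = 0 ∨ T.card = 1 ∨ T.card = 2 ∨ T.card = 3 := by omega
  · rw [Finset.card_eq_zero] at h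
    subst h
    exact ⟨fun _ => d, 0, fun _ => hd, fun _ => le_rfl, fun Kf σ => by simp⟩
  · obtain ⟨i, rfl⟩ := Finset.card_eq_one.1 h
    exact ⟨![i, d, d], ![1, 0, 0], fun j => by fin_cases j <;> simp [ho i (by simp), hd],
      fun j => by fin_cases j <;> simp, fun Kf σ => by simp [Fin.sum_univ_three]⟩
  · obtain ⟨i, k, hik, rfl⟩ := Finset.card_eq_two.1 h
    exact ⟨![i, k, d], ![1, 1, 0],
      fun j => by fin_cases j <;> simp [ho i (by simp), ho k (by simp), hd],
      fun j => by fin_cases j <;> simp,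
      fun Kf σ => by rw [Finset.sum_pair hik]; simp [Fin.sum_univ_three]⟩
  · obtain ⟨i, k, l, hik, hil, hkl, rfl⟩ := Finset.card_eq_three.1 h
    exact ⟨![i, k, l], ![1, 1, 1],
      fun j => by fin_cases j <;> simp [ho i (by simp), ho k (by simp), ho l (by simp)],
      fun j => by fin_cases j <;> simp,
      fun Kf σ => by
        rw [Finset.sum_insert (by simp [hik, hil]), Finset.sum_pair hkl]
        simp [Fin.sum_univ_three, add_assoc]⟩

/-- **The local field at `x` over a neighbour set.** If every neighbour of `x` lies in `T`, then
`H(K') = H(K' with the bonds at x off) + σ_x ∑_{z ∈ T} K^x_z σ_z` for every `K'` agreeing with `K`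
on the bonds at `x`, where `K^x_z ≥ 0` is the total coupling between `x` and `z`. [folklore] -/
theorem twin_field {n m : ℕ} (K : Fin m → ℝ) (C : Fin m → Finset (Fin n)) (hK : ∀ i, 0 ≤ K i)
    (hC : ∀ i, (C i).card = 2) (x : Fin n) (T : Finset (Fin n))
    (hT : ∀ i, x ∈ C i → ∀ z ∈ C i, z ≠ x → z ∈ T) :
    ∃ Kf : Fin n → ℝ, (∀ z, 0 ≤ Kf z) ∧
      ∀ K' : Fin m → ℝ, (∀ i, x ∈ C i → K' i = K i) → ∀ ω, gksHamiltonian Finset.univ K' C ω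
        = gksHamiltonian Finset.univ (fun i => if x ∈ C i then 0 else K' i) C ω
          + spinAt x ω * ∑ z ∈ T, Kf z * spinAt z ω := by
  -- adapted from `c2_site` (…ImNonadjOfLaw2Aux.lean): group the bonds at `x` by their far end
  have hex : ∀ i, ∃ p, x ∈ C i → p ≠ x ∧ C i = {x, p} := by
    intro i
    by_cases hx : x ∈ C i
    · obtain ⟨p, q, hpq, hCi⟩ := Finset.card_eq_two.1 (hC i)
      rw [hCi, Finset.mem_insert, Finset.mem_singleton] at hx
      rcases hx with rfl | rfl
      · exact ⟨q, fun _ => ⟨hpq.symm, hCi⟩⟩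
      · exact ⟨p, fun _ => ⟨hpq, hCi.trans (Finset.pair_comm _ _)⟩⟩
    · exact ⟨x, fun h => absurd h hx⟩
  choose o ho using hex
  have hoT : ∀ i ∈ Finset.univ.filter (fun i => x ∈ C i), o i ∈ T := fun i hi => by
    have hx : x ∈ C i := (Finset.mem_filter.1 hi).2
    obtain ⟨hox, hCi⟩ := ho i hx
    exact hT i hx (o i) (by rw [hCi]; simp) hox
  refine ⟨fun z => ∑ i ∈ Finset.univ.filter (fun i => x ∈ C i) with o i = z, K i,
    fun z => Finset.sum_nonneg fun i _ => hK i, fun K' hK' ω => ?_⟩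
  have hsum : ∑ z ∈ T, (∑ i ∈ Finset.univ.filter (fun i => x ∈ C i) with o i = z, K i) * spinAt z ω
      = ∑ i ∈ Finset.univ.filter (fun i => x ∈ C i), K i * spinAt (o i) ω :=
    calc ∑ z ∈ T, (∑ i ∈ Finset.univ.filter (fun i => x ∈ C i) with o i = z, K i) * spinAt z ω
        = ∑ z ∈ T, ∑ i ∈ Finset.univ.filter (fun i => x ∈ C i) with o i = z,
            K i * spinAt (o i) ω :=
          Finset.sum_congr rfl fun z _ => by
            rw [Finset.sum_mul]
            exact Finset.sum_congr rfl fun i hi => by rw [(Finset.mem_filter.1 hi).2]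
      _ = ∑ i ∈ Finset.univ.filter (fun i => x ∈ C i), K i * spinAt (o i) ω :=
          Finset.sum_fiberwise_of_maps_to hoT _
  rw [hsum, Finset.sum_filter]
  simp only [gksHamiltonian, Finset.mul_sum, ← Finset.sum_add_distrib]
  refine Finset.sum_congr rfl fun i _ => ?_
  by_cases hx : x ∈ C i
  · obtain ⟨hox, hCi⟩ := ho i hx
    rw [if_pos hx, if_pos hx, hK' i hx, hCi, spinProduct, Finset.prod_pair hox.symm]
    ring
  · simp [hx]

/-- `u ⬝ N u = ∑_{p,q} u_p N_pq u_q`. [folklore] -/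
theorem twin_dot_mulVec {J : Type*} [Fintype J] (u : J → ℝ) (N : Matrix J J ℝ) :
    u ⬝ᵥ (N *ᵥ u) = ∑ p, ∑ q, u p * N p q * u q := by
  simp only [dotProduct, Matrix.mulVec, Finset.mul_sum]
  exact Finset.sum_congr rfl fun p _ => Finset.sum_congr rfl fun q _ => by ring

/-- Registered stub `helper_twin_nonpos` (W1 of line `Sketch`, degree-3 twins): for non-adjacent
`x ≠ y` with `deg x ≤ 3` and the same neighbours, `(Σ⁻¹)_xy ≤ 0`.  With `R = univ ∖ {x,y}` and
three common slots `v_j` (`twin_slots`, `twin_field`), `E[σ_x | σ_R] = tanh h_x = (linear) + κ_x e`,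
`E[σ_y | σ_R] = (linear) + κ_y e` with the same cubic `e = σ_{v₀}σ_{v₁}σ_{v₂}` and `κ_x, κ_y ≤ 0`
(`c2_three`); `σ_x ⊥ σ_y | σ_R`, so `PCov(x,y|R) = Res(tanh h_x, tanh h_y) = κ_xκ_y Res(e, e)`
(`c2_integrate`, `c2_res_lin`, `c2_res_symm`) and `Res(e, e) ≥ 0` is a Gram residual
(`l3_gram_residual_nonneg`); S1 (`stub_entry_nonpos_of_pcov`) concludes.  Degree `≤ 2` is C3
(`stub_row_deg_le_two`); the bound `deg y ≤ 3` is not needed. [folklore] -/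
theorem helper_twin_nonpos :
    ∀ (n m : ℕ) (K : Fin m → ℝ) (C : Fin m → Finset (Fin n)), (∀ i, 0 ≤ K i) → (∀ i, (C i).card = 2) →
      ∀ x y : Fin n, x ≠ y → (∀ i, ¬ (x ∈ C i ∧ y ∈ C i)) →
        (Finset.univ.filter (fun i => x ∈ C i)).card ≤ 3 → (Finset.univ.filter (fun i => y ∈ C i)).card ≤ 3 →
        (∀ z : Fin n, z ≠ x → z ≠ y → ((∃ i, x ∈ C i ∧ z ∈ C i) ↔ (∃ i, y ∈ C i ∧ z ∈ C i))) →
          (Matrix.of fun p q : Fin n => gksExpect Finset.univ K C (fun ω => spinAt p ω * spinAt q ω))⁻¹ x y ≤ 0 := by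
  intro n m K C hK hC x y hxy hnadj hdx _hdy htwin
  -- sites of degree `≤ 2`: C3
  by_cases hdx2 : (Finset.univ.filter fun i => x ∈ C i).card ≤ 2
  · exact stub_row_deg_le_two n m K C hK hC x y hxy hdx2
  -- a site `d ∉ {x, y}` (a neighbour of `x`)
  obtain ⟨d, hdx', hdy'⟩ : ∃ d : Fin n, d ≠ x ∧ d ≠ y := by
    obtain ⟨i, hi⟩ : (Finset.univ.filter fun i => x ∈ C i).Nonempty := by
      rw [← Finset.card_pos]; omega
    have hxi : x ∈ C i := (Finset.mem_filter.1 hi).2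
    obtain ⟨p, hp, hpx⟩ := Finset.exists_mem_ne (s := C i) (by rw [hC i]; norm_num) x
    exact ⟨p, hpx, fun h => hnadj i ⟨hxi, h ▸ hp⟩⟩
  -- the common neighbour set `T` of `x` and `y`
  obtain ⟨T, hTdef⟩ : ∃ T : Finset (Fin n),
      T = (Finset.univ.filter fun i => x ∈ C i).biUnion fun i => (C i).erase x := ⟨_, rfl⟩
  have hTmem : ∀ z, z ∈ T ↔ z ≠ x ∧ ∃ i, x ∈ C i ∧ z ∈ C i := fun z => by
    rw [hTdef, Finset.mem_biUnion]
    simp only [Finset.mem_filter, Finset.mem_univ, true_and, Finset.mem_erase]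
    exact ⟨fun ⟨i, hxi, hzx, hzi⟩ => ⟨hzx, i, hxi, hzi⟩, fun ⟨hzx, i, hxi, hzi⟩ => ⟨i, hxi, hzx, hzi⟩⟩
  have hT3 : T.card ≤ 3 := by
    rw [hTdef]
    refine Finset.card_biUnion_le.trans ?_
    have h1 : ∀ i ∈ Finset.univ.filter (fun i => x ∈ C i), ((C i).erase x).card = 1 :=
      fun i hi => by rw [Finset.card_erase_of_mem (Finset.mem_filter.1 hi).2, hC i]
    rw [Finset.sum_congr rfl h1, Finset.sum_const, smul_eq_mul, mul_one]
    exact hdx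
  have hTP : ∀ z ∈ T, z ≠ x ∧ z ≠ y := fun z hz => by
    obtain ⟨hzx, i, hxi, hzi⟩ := (hTmem z).1 hz
    exact ⟨hzx, fun h => hnadj i ⟨hxi, h ▸ hzi⟩⟩
  have hTx : ∀ i, x ∈ C i → ∀ z ∈ C i, z ≠ x → z ∈ T := fun i hxi z hzi hzx =>
    (hTmem z).2 ⟨hzx, i, hxi, hzi⟩
  have hTy : ∀ i, y ∈ C i → ∀ z ∈ C i, z ≠ y → z ∈ T := fun i hyi z hzi hzy => by
    have hzx : z ≠ x := fun h => hnadj i ⟨h ▸ hzi, hyi⟩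
    exact (hTmem z).2 ⟨hzx, (htwin z hzx hzy).2 ⟨i, hyi, hzi⟩⟩
  -- three common slots `v_j` and the local fields `h_x = ∑ a_j σ_{v_j}`, `h_y = ∑ b_j σ_{v_j}`
  obtain ⟨v, ε, hv, hε, hslot⟩ := twin_slots T hT3 (fun p => p ≠ x ∧ p ≠ y) d ⟨hdx', hdy'⟩ hTP
  obtain ⟨Kf, hKf, hHx⟩ := twin_field K C hK hC x T hTx
  obtain ⟨Kg, hKg, hHy⟩ := twin_field K C hK hC y T hTy
  obtain ⟨a, ha'⟩ : ∃ a : Fin 3 → ℝ, ∀ j, a j = ε j * Kf (v j) := ⟨_, fun _ => rfl⟩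
  obtain ⟨b, hb'⟩ : ∃ b : Fin 3 → ℝ, ∀ j, b j = ε j * Kg (v j) := ⟨_, fun _ => rfl⟩
  have ha : ∀ j, 0 ≤ a j := fun j => by rw [ha']; exact mul_nonneg (hε j) (hKf _)
  have hb : ∀ j, 0 ≤ b j := fun j => by rw [hb']; exact mul_nonneg (hε j) (hKg _)
  obtain ⟨α, κx, _cx, _Jx, hκx, _hJx, h3x⟩ := c2_three a ha
  obtain ⟨β, κy, _cy, _Jy, hκy, _hJy, h3y⟩ := c2_three b hb
  obtain ⟨hx, hhx⟩ : ∃ hx : SpinConfig (Fin n) → ℝ, ∀ ω, hx ω = ∑ j, a j * spinAt (v j) ω :=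
    ⟨_, fun _ => rfl⟩
  obtain ⟨hy, hhy⟩ : ∃ hy : SpinConfig (Fin n) → ℝ, ∀ ω, hy ω = ∑ j, b j * spinAt (v j) ω :=
    ⟨_, fun _ => rfl⟩
  have hxT : ∀ ω, ∑ z ∈ T, Kf z * spinAt z ω = hx ω := fun ω => by
    rw [hhx]
    refine (hslot Kf (fun z => spinAt z ω)).trans ?_
    exact Finset.sum_congr rfl fun j _ => by rw [ha']
  have hyT : ∀ ω, ∑ z ∈ T, Kg z * spinAt z ω = hy ω := fun ω => by
    rw [hhy]
    refine (hslot Kg (fun z => spinAt z ω)).trans ?_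
    exact Finset.sum_congr rfl fun j _ => by rw [hb']
  have hH1 : ∀ ω, gksHamiltonian Finset.univ K C ω
      = gksHamiltonian Finset.univ (fun i => if x ∈ C i then 0 else K i) C ω + spinAt x ω * hx ω :=
    fun ω => by rw [← hxT]; exact hHx K (fun _ _ => rfl) ω
  have hH2 : ∀ ω, gksHamiltonian Finset.univ K C ω
      = gksHamiltonian Finset.univ (fun i => if y ∈ C i then 0 else K i) C ω + spinAt y ω * hy ω :=
    fun ω => by rw [← hyT]; exact hHy K (fun _ _ => rfl) ω
  have hvx : ∀ j, v j ≠ x := fun j => (hv j).1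
  have hvy : ∀ j, v j ≠ y := fun j => (hv j).2
  have hx_x : ∀ ω, hx (ω * Pi.mulSingle x (-1)) = hx ω := fun ω => by
    rw [hhx, hhx]; exact Finset.sum_congr rfl fun j _ => by rw [pcm2im_spinAt_flip_ne (hvx j)]
  have hx_y : ∀ ω, hx (ω * Pi.mulSingle y (-1)) = hx ω := fun ω => by
    rw [hhx, hhx]; exact Finset.sum_congr rfl fun j _ => by rw [pcm2im_spinAt_flip_ne (hvy j)]
  have hy_y : ∀ ω, hy (ω * Pi.mulSingle y (-1)) = hy ω := fun ω => by
    rw [hhy, hhy]; exact Finset.sum_congr rfl fun j _ => by rw [pcm2im_spinAt_flip_ne (hvy j)]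
  -- the conditional expectations `E[σ_x F] = E[tanh(h_x) F]`, `E[σ_y F] = E[tanh(h_y) F]`
  have hEx : ∀ F : SpinConfig (Fin n) → ℝ, (∀ ω, F (ω * Pi.mulSingle x (-1)) = F ω) →
      gksExpect Finset.univ K C (fun ω => spinAt x ω * F ω)
        = gksExpect Finset.univ K C (fun ω => Real.tanh (hx ω) * F ω) :=
    fun F hF => (c2_integrate Finset.univ K _ C x hx hH1 (fun i _ hi => if_pos hi) hx_x F hF).1
  have hEy : ∀ F : SpinConfig (Fin n) → ℝ, (∀ ω, F (ω * Pi.mulSingle y (-1)) = F ω) →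
      gksExpect Finset.univ K C (fun ω => spinAt y ω * F ω)
        = gksExpect Finset.univ K C (fun ω => Real.tanh (hy ω) * F ω) :=
    fun F hF => (c2_integrate Finset.univ K _ C y hy hH2 (fun i _ hi => if_pos hi) hy_y F hF).1
  -- the normalised weight `P ≥ 0` of `μ`
  obtain ⟨P, hPdef⟩ : ∃ P : SpinConfig (Fin n) → ℝ,
      ∀ ω, P ω = gksWeight Finset.univ K C ω / gksSum Finset.univ K C (fun _ => 1) :=
    ⟨_, fun _ => rfl⟩
  have hP : ∀ f : SpinConfig (Fin n) → ℝ, gksExpect Finset.univ K C f = ∑ ω, P ω * f ω := fun f => by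
    simp only [gksExpect, gksSum, Finset.sum_div, hPdef]
    exact Finset.sum_congr rfl fun ω _ => by ring
  have hP0 : ∀ ω, 0 ≤ P ω := fun ω => by
    rw [hPdef]
    exact div_nonneg (gksWeight_pos _ _ _ ω).le (gksSum_one_pos _ _ _).le
  -- the matrix `G = Σ`, the set `S = univ ∖ {x, y}` and the Schur step S1
  obtain ⟨G, hG⟩ : ∃ G : Matrix (Fin n) (Fin n) ℝ, G = Matrix.of fun p q : Fin n =>
      gksExpect Finset.univ K C (fun ω => spinAt p ω * spinAt q ω) := ⟨_, rfl⟩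
  have hGe : ∀ p q, G p q = gksExpect Finset.univ K C (fun ω => spinAt p ω * spinAt q ω) :=
    fun p q => by rw [hG]; rfl
  rw [← hG]
  obtain ⟨S, hS⟩ : ∃ S : Finset (Fin n), S = (Finset.univ.erase x).erase y := ⟨_, rfl⟩
  have hS1 : ∀ p : ↥S, p.1 ≠ x ∧ p.1 ≠ y := fun p => by
    have h : p.1 ∈ (Finset.univ.erase x).erase y := by rw [← hS]; exact p.2
    rw [Finset.mem_erase, Finset.mem_erase] at h
    exact ⟨h.2.1, h.1⟩
  refine stub_entry_nonpos_of_pcov n m K C hK hC G hG x y S hxy hS ?_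
  obtain ⟨M, hMd⟩ : ∃ M : Matrix ↥S ↥S ℝ,
      M = G.submatrix (Subtype.val : ↥S → Fin n) (Subtype.val : ↥S → Fin n) := ⟨_, rfl⟩
  rw [← hMd]
  obtain ⟨χ, hχ⟩ : ∃ χ : ↥S → SpinConfig (Fin n) → ℝ, ∀ p ω, χ p ω = spinAt p.1 ω :=
    ⟨_, fun _ _ => rfl⟩
  have hM : ∀ p q, M p q = ∑ ω, P ω * (χ p ω * χ q ω) := fun p q => by
    rw [hMd, Matrix.submatrix_apply, hGe, hP]
    simp only [hχ]
  have hM' : ∀ p q, M p q = ∑ ω, P ω * χ p ω * χ q ω := fun p q => by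
    rw [hM]
    exact Finset.sum_congr rfl fun ω _ => by ring
  have hdet : IsUnit M.det := by
    have hpd : M.PosDef := by
      rw [hMd, hG]
      exact (schur_posDef n m K C).submatrix Subtype.val_injective
    exact (Matrix.isUnit_iff_isUnit_det M).mp hpd.isUnit
  -- `PCov(x,y|S) = Res(f_x, f_y)` with `f_x = tanh h_x`, `f_y = tanh h_y`
  obtain ⟨fx, hfx⟩ : ∃ fx : SpinConfig (Fin n) → ℝ, ∀ ω, fx ω = Real.tanh (hx ω) :=
    ⟨_, fun _ => rfl⟩
  obtain ⟨fy, hfy⟩ : ∃ fy : SpinConfig (Fin n) → ℝ, ∀ ω, fy ω = Real.tanh (hy ω) :=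
    ⟨_, fun _ => rfl⟩
  have hGxy : G x y = ∑ ω, P ω * (fx ω * fy ω) := by
    rw [hGe, hEx _ (fun ω => pcm2im_spinAt_flip_ne hxy.symm ω)]
    have h1 : (fun ω => Real.tanh (hx ω) * spinAt y ω) = fun ω => spinAt y ω * Real.tanh (hx ω) :=
      funext fun ω => mul_comm _ _
    rw [h1, hEy _ (fun ω => by rw [hx_y]), hP]
    exact Finset.sum_congr rfl fun ω _ => by rw [hfx, hfy]; ring
  have hGxp : ∀ p : ↥S, G x p.1 = ∑ ω, P ω * (fx ω * χ p ω) := fun p => by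
    rw [hGe, hEx _ (fun ω => pcm2im_spinAt_flip_ne (hS1 p).1 ω), hP]
    exact Finset.sum_congr rfl fun ω _ => by rw [hfx, hχ]
  have hGqy : ∀ q : ↥S, G q.1 y = ∑ ω, P ω * (fy ω * χ q ω) := fun q => by
    rw [hGe]
    have h1 : (fun ω => spinAt q.1 ω * spinAt y ω) = fun ω => spinAt y ω * spinAt q.1 ω :=
      funext fun ω => mul_comm _ _
    rw [h1, hEy _ (fun ω => pcm2im_spinAt_flip_ne (hS1 q).2 ω), hP]
    exact Finset.sum_congr rfl fun ω _ => by rw [hfy, hχ]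
  rw [hGxy]
  simp only [hGxp, hGqy]
  -- the Walsh forms of `f_x`, `f_y` over the common slots, with the common cubic `e`
  have hvS : ∀ j, v j ∈ S := fun j => by rw [hS]; simp [hvx j, hvy j]
  obtain ⟨ι, hι⟩ : ∃ ι : Fin 3 → ↥S, ∀ j, (ι j).1 = v j := ⟨fun j => ⟨v j, hvS j⟩, fun _ => rfl⟩
  obtain ⟨e, he⟩ : ∃ e : SpinConfig (Fin n) → ℝ,
      ∀ ω, e ω = spinAt (v 0) ω * spinAt (v 1) ω * spinAt (v 2) ω := ⟨_, fun _ => rfl⟩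
  have tx : ∀ ω, fx ω = ∑ j, α j * χ (ι j) ω + κx * e ω := fun ω => by
    rw [hfx, hhx, he]
    simp only [hχ, hι]
    exact (h3x (fun j => spinAt (v j) ω) (fun j => spinAt_eq_one_or_eq_neg_one _ _)).1
  have ty : ∀ ω, fy ω = ∑ j, β j * χ (ι j) ω + κy * e ω := fun ω => by
    rw [hfy, hhy, he]
    simp only [hχ, hι]
    exact (h3y (fun j => spinAt (v j) ω) (fun j => spinAt_eq_one_or_eq_neg_one _ _)).1
  rw [c2_res_lin P χ M hM hdet fx e fy ι α κx tx, c2_res_symm P χ M hM e fy,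
    c2_res_lin P χ M hM hdet fy e e ι β κy ty, ← mul_assoc]
  refine mul_nonneg (mul_nonneg_of_nonpos_of_nonpos hκx hκy) ?_
  -- `Res(e, e) ≥ 0`: a Gram residual
  have key := l3_gram_residual_nonneg P hP0 χ e M hM' hdet
  rw [twin_dot_mulVec] at key
  simpa only [mul_assoc] using key

end

end Summit.CriticalPhenomena.Ising3DConformalLimit.Cruxes.InverseMFerromagnet.PartialCovarianceLadder
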